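import Summits.QuantumFields.YangMills.Theorems.BalabanUVNodesN16HolderMSAtRecord13CoPR
import Summits.QuantumFields.YangMills.Theorems.BalabanUVNodesN16LettersOfEdgesAllTorus

/-!
# Route «BalabanUVNodes», cluster K4 «SpineRates» — node N16 = NE3 AT dag-n22-e's NAMED STAGE-13 READING OF RECORD `readingOfRecord₁₃CoPR w1 ℓ₃ ne2 ne1` FROM ITS TWO IN-EDGES
# BY NAME, LETTERS CHOSEN, WITH NODE N05's CONJUNCTS AT THE PINNED ALL-TORUS PROPER SUB-INDEX (R-b″ on N16's record side): N05's unpacked leaf (`Thm4Body` ∕ `Prop3Body` on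
# `fun i : {i : ZdIdx 4 F.L // (∀ j, i.Ω j = univ) ∧ … ∧ i.η = ((F.L : ℝ)⁻¹) ^ i.k} ↦ zdGF3 (M_N ℂ) F.L β len i.1` with constants and window) and N07's linear leaf at EVERY family,
# and a coupling letter `g F > 0`, give letters of record `ℓ₃` with the K3 composer's `h16 : S_N16 (RRec₁₃CoPROn (readingOfRecord₁₃CoPR w1 ℓ₃ ne2 ne1) Rg)` (and the R-β ∕ R-β″
# currencies, and the canonical home) TOGETHER WITH the per-family proviso, AT-slot and dag-n21-d's numerals

CoPR EDITION (director-ym №169 H1 ∕ №174 PRESS WORD ∕ №176 — FINDING №8 = LOCATED-8; node00-def-T FILE 25 `Node00/Record13CoPR.lean` p529474 + FILE 26T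
`Node00/Record13SepCoPR.lean` p529780, KEY-RULE-25 ∕ `KEYMAP-Record13-v1.6.md`; plan g69 rev 22 (commit 2d048f7e82a7); dag-lead WORDS-142 l.19649 — 2026-08-27): RECORD 13 v1.6
adds the RUN-INDEXED residual 𝐓-weight slot — `structure Stage13RParams … extends Stage13Params` with the one new field `Zr : (p : B12.RunParams) → TkResidualW Fam N (FluctV N) p.K`,
proviso `Stage13RParams.Provisos₁₃CoPR` (the v1.2 core rows verbatim at `θ.toStage13Params` + `zrLaws ∕ zrLocal`), `towerOfRecord₁₃CoPR ∕ datumOfRecord₁₃CoPR`, record class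
`IsRecordOfRecord₁₃CCoPR`, guard `Stage13RParams.ZrUnity`; node00-def-RR-2's key `Node00/Record13DatumKeyCoPR` (`IsDatumOfRecord₁₃CCoPR(On∕N)`, `.params ∕ .provisos ∕ .admissible`,
`isDatumOfRecord₁₃CCoPR_datumOfRecord₁₃CoPR`, the guard of record `unityNondeg₁₃R`) and dag-n22-e's (T-RATE) layer-B ∕ reading-of-record CoPR ports (`RateReading₁₃CoPR`,
`rateCarriersOfRecord₁₃CoPR`, `RRec₁₃CoPR`, `RRec₁₃CoPROn`, `readingOfRecord₁₃CoPR`, …) followed; the items K0⁶–K3⁶ (stmt-QuantumFields-20506–20509) key on v1.6 `Provisos₁₃SepCoPR` ∕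
`datumOfRecord₁₃SepCoPR` (= `datumOfRecord₁₃CoPR θ h.toCore`, `rfl`), bg-blind consumer storeys on `Provisos₁₃CoPR` at the CoPR datum (director-ym №174 (3): «pens port their OWN
files»).  THIS FILE is the TOKEN TWIN of this seat's v1.5 module `…N16OfEdgesAllTorusAtRecord13CoP` (p528102) under T₆: binder `(θ : Stage13Params F N) ↦ (θ : Stage13RParams F N)`
(regimes `Rg`, run-length selectors `ksel`, tuple readings `rr` re-typed with it; `θ.Admissible F N` read through the parent structure), `Provisos₁₃Core ↦ Provisos₁₃CoPR`, every
`…CoP…` record ∕ key ∕ home ∕ reading ∕ module stem `↦ …CoPR…` — statements = the v1.5 statements under that map; proofs VERBATIM; θ-free names (RR-1's `ne3ConstLayerOfRecord₁₁` ∕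
`ne3NperOfRecord₁₁` ∕ `ne3DomOfRecord₁₁`, `InEndRegime`, `LeafSlot`, the AT slots, dag-n16-c's β-kit, …) VERBATIM; stage-free lemmas NOT re-declared (imported BY NAME); N16 reads no field
of the key (no `Zr`, no `Zt`, no `bg`, no transport face — KEY-RULE-25's SITE-RULE has no site in this file); the tuple-currency (K3 `KeyedRates rr`) conjuncts are CITED from this
seat's BINDER-GENERIC modules `…N16AtTupleReadingBinderGeneric` ∕ `…N16HolderMSAtTupleReadingBinderGeneric` (generation 8, p530924 ∕ p531947: key type, proviso and admissibility
are variables; every binder's storey is an instance by unification).  NOTE (LOCATED-4∕5 of dag-n16-e ∕ dag-n16-c): every «THE N16 LINE» keyed on the law-free univ sub-family is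
VACUOUS as stated (n16-c F49); the LIVE lines carry N05's conjunct at the pinned all-torus proper sub-index (`…AllTorusAtRecord13CoPR`).  The v1.5 CoP ∕ Co ∕ ⁗ ∕ ‴ siblings and
the item ids they name are ASIDES (kind `aside` since rev 22); the lane is K3⁶ `SpineGivenEndpointR13SepCoPR` = stmt-QuantumFields-20509 (dag-lead WORDS-142), filed
`--kind proof --supports stmt-QuantumFields-20509 --as helper`.

Cell `pub-ymgap`, seat `pub-ymgap-dag-n16-e` (R134 acceleration seat (a), strategy s2 = BY-NAME KNIT at the record; HUMAN RULING D-0062; chair R424 venue), generation 8,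
module 37ᴿ (THEOREMS ONLY, 0 `def`, 0 `sorry`, standard axioms).  `--kind proof --supports <K3 id of record> --as helper` (v1.6 CoPR: stmt-QuantumFields-20509, WORDS-142).  `bears_on: R4∕N16 · edges N05 → N16, N07 → N16 ·
out-edge N16 → N21`.  Over module 35 `…N16LettersOfEdgesAllTorus` (the STAGE-FREE per-family «letters chosen» lemmas), this seat's home modules `…N16AtRRec13CoPR` ∕
`…N16AtRRec13CoPRLines` ∕ `…N16HolderMSAtRecord13CoPR` (constant-layer iffs; through them dag-n22-e's `…RateReadingOfRecord13CoPR` with the face `readingOfRecord₁₃CoPR_ne3`) and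
module 32's closers.  Statements = this seat's landed «FROM ITS TWO IN-EDGES» theorems (modules 27∕28 and their twins) with the N05 family's index subtype swapped and `LeafSlot… ↦
LeafSlot…AT` in the returned per-family clause; suffix `_allTorus`.  Restates nothing.

WHY (LOCATED-4∕5; modules 32–36).  These are the reading-level statements a discharge instantiates: no letter line is left to the composer, `Rg` ∕ `w1` ∕ `ne2` ∕ `ne1` free;
their univ-keyed originals are VACUOUS as stated (dag-n16-c F49), these are live (pinned members have canonical non-empty bonds and lie inside n05-c's `IdxB8SubB`).
IN-EDGE INTERFACES: N05 = `∀ F, ∃ len c₁ c₁' B₁' cP C₂ B₀β inp, (len lines) ∧ (constants) ∧ (window) ∧ Thm4Body … ∧ Prop3Body …` on the pinned sub-family at exponent `1` ∕ `β`;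
N07 = `∀ F, ∃ C ε₀, 0 ≤ C ∧ 0 < ε₀ ∧ ∀ ε ∈ ]0, ε₀], LeafH3sup 4 F.L (ne3NperOfRecord₁₁ F 0 0) ε (C·ε) (C·ε) (ne3DomOfRecord₁₁ F N 0 0)`.

CONTENT.  §1 ★ `exists_letters_s_N16_readingOfRecord₁₃CoPROn_of_edges_allTorus` · `exists_letters_s_N16_readingOfRecord₁₃CoPR_of_edges_allTorus`; §2 (R-β) ★
`exists_letters_s_N16Holder_readingOfRecord₁₃CoPROn_of_edges_allTorus` · `…₁₃CoPR_of_edges_allTorus`; §3 (R-β″) ★ `exists_letters_s_N16HolderMS_readingOfRecord₁₃CoPROn_of_edges_allTorus` ·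
`…₁₃CoPR_of_edges_allTorus`.

HONEST FRAMING.  Kernel bookkeeping by name (a `choose` over displayed letter lines); no estimate; N05's `Thm4Body` ∕ `Prop3Body` ([Balaban1985RegularSpaces] Thm 4 ∕ Prop 3 TYPES at
the pinned all-torus proper members) and N07's linear `LeafH3sup` ([Balaban1985Variational] Thm 1 (8)+(10) TYPE) are HYPOTHESES asserted for no family; `w1` ∕ `ne2` ∕ `ne1` are
residual DATA; no admissible Stage-13 tuple of this edition is claimed to exist (K0 OPEN); the (42)∕(0.4) averaging transfer (N21's `hdict`) and the Hölder-pin ruling untouched;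
nothing of Bałaban's asserted; **N16 ∕ NE3 is NOT discharged**; count-neutral (typed 28∕28 · discharged 5∕27, A 5∕28 UNMOVED); one finite four-torus at fixed ε — NOT ℝ⁴, NOT
infinite volume, NOT OS, NOT a mass gap, NOT Clay.
-/

set_option autoImplicit false

open scoped BigOperators Matrix Matrix.Norms.L2Operator
open NormedSpace

namespace Summit.QuantumFields.YangMills.BalabanUVNodes.N16OfEdgesAllTorusAtRecord13CoPR

open Literature.MathematicalPhysics.QuantumFieldTheory.Balaban1983to89
open Literature.MathematicalPhysics.QuantumFieldTheory.Balaban1983to89.T4Continuum (T4Family ULoop)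
open B7Prop1Explicit B7Prop2Explicit
open B7Prop3Flat (c3)
open B8LeafModelZd (ZdIdx)
open B8LeafModelZd3 (zdGF3)
open Node00 (Stage13RParams NE3Objects₁₁ NE3Letters₁₁ NE2Objects₁₁ ne3ConstLayerOfRecord₁₁ ne3NperOfRecord₁₁ ne3DomOfRecord₁₁ MatA)
open Node00.W1 (ReadingData)
open Summit.QuantumFields.BalabanUV.T4Continuum
open NE3.LeafIndexSockets (LeafH3sup)
open YMDAG.UVSplit (Datum NE3Carriers NE1pCarriers S_N16 ne3OfRecord₁₁ RRec₁₃CoPR RRec₁₃CoPROn readingOfRecord₁₃CoPR readingOfRecord₁₃CoPR_ne3)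
open Summit.QuantumFields.YangMills.BalabanUVNodes.N16Regime (InEndRegime radiusOfRecord constOfRecord)
open Summit.QuantumFields.YangMills.BalabanUVNodes.N16HolderDefs (S_N16Holder)
open Summit.QuantumFields.YangMills.BalabanUVNodes.N16HolderMSDefs (S_N16HolderMS)
open Summit.QuantumFields.YangMills.BalabanUVNodes.N16HolderRegime (InEndRegimeH radiusOfRecordH constOfRecordH)
open Summit.QuantumFields.YangMills.BalabanUVNodes.N16HolderMSRegime (InEndRegimeHMS radiusOfRecordHMS constOfRecordHMS)
open Summit.QuantumFields.YangMills.BalabanUVNodes.N16AtRRec13CoPR (s_N16_rRec₁₃CoPROn_iff_ofRecord s_N16_rRec₁₃CoPR_iff_of_constLayer)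
open Summit.QuantumFields.YangMills.BalabanUVNodes.N16AtRRec13CoPRLines (s_N16Holder_rRec₁₃CoPROn_iff_ofRecord s_N16Holder_rRec₁₃CoPR_iff_of_constLayer)
open Summit.QuantumFields.YangMills.BalabanUVNodes.N16HolderMSAtRecord13CoPR (s_N16HolderMS_rRec₁₃CoPROn_iff_ofRecord s_N16HolderMS_rRec₁₃CoPR_iff_ofRecord)
open Summit.QuantumFields.YangMills.BalabanUVNodes.N16LeafSlotAllTorus (LeafSlotAT LeafSlotHolderAT LeafSlotHolderMSAT n16At_of_inEndRegime_leafSlotAT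
  n16HolderAt_of_inEndRegimeH_leafSlotHolderAT n16HolderMSAt_of_inEndRegimeHMS_leafSlotHolderMSAT)
open Summit.QuantumFields.YangMills.BalabanUVNodes.N16LettersOfEdgesAllTorus (exists_letters_inEndRegime_leafSlotAT_of_edges exists_letters_inEndRegimeH_leafSlotHolderAT_of_edges
  exists_letters_inEndRegimeHMS_leafSlotHolderMSAT_of_edges)

noncomputable section

variable {N : ℕ} [NeZero N]

/-! ## §1 β = 1, the stub of record `S_N16` -/

section One

variable (Rg : (F : T4Family) → Stage13RParams F N → Prop)
  (w1 : (F : T4Family) → (θ : Stage13RParams F N) → ReadingData F (MatA N) θ.τ9.M)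
  (ne2 : (F : T4Family) → Stage13RParams F N → (ℕ → ℝ) → List (ULoop F) → ℕ → NE2Objects₁₁)
  (ne1 : (F : T4Family) → Stage13RParams F N → (ℕ → ℝ) → List (ULoop F) → NE1pCarriers)

/-- ★ **N16 AT THE REGIME-RESTRICTED READING OF RECORD FROM ITS TWO IN-EDGES, LETTERS CHOSEN** (β = 1): N05's unpacked leaf (conjuncts at the PINNED all-torus proper sub-index) and N07's linear leaf at EVERY family (both are about
`F.L`-indexed objects and read no Stage-13 tuple), and a coupling letter `g F > 0`, give letters of record `ℓ₃` with the K3‴ composer's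
`h16 : S_N16 (RRec₁₃CoPROn (readingOfRecord₁₃CoPR w1 ℓ₃ ne2 ne1) Rg)` (module 35's per-family letters, the home's constant-layer iff, module 32's closer) AND, at every family, THE END's proviso, `LeafSlotAT`, and
dag-n21-d's numerals at `ℓ₃ F` — no letter line is left to the composer; `Rg`, `w1`, `ne2`, `ne1` free. [folklore] -/
theorem exists_letters_s_N16_readingOfRecord₁₃CoPROn_of_edges_allTorus {g : T4Family → ℝ} (hg : ∀ F, 0 < g F)
    (h5 : ∀ F : T4Family, letI : CStarAlgebra (Matrix (Fin N) (Fin N) ℂ) := {}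
      ∃ (len : Site 4 → ℝ) (c₁ c₁' B₁' cP C₂ B₀β : ℝ) (inp : B8.B9Inputs),
        (∀ v : Site 4, 0 < len v → 1 ≤ len v) ∧ (∀ μ : Fin 4, len (e μ) = 1) ∧ 0 < B₁' ∧ 5 * ((4 : ℕ) : ℝ) * F.L * inp.B₀ ≤ B₁' ∧ 0 < c₁' ∧
        (∀ α₀ α₁ : ℝ, 0 < α₀ → 0 < α₁ → α₀ + α₁ ≤ c₁' →
          α₀ + α₁ ≤ c₁ ∧ C0 4 * (2 * α₀) ≤ 1 / 3 ∧ 4 * α₀ ≤ c2' 4 F.L ∧ 16 * (B₁' * (α₀ + α₁)) ≤ 1 ∧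
          Real.exp (4 * (800 * (((4 : ℕ) : ℝ) + 1) ^ 2 * (((4 : ℕ) : ℝ) + 4)) * α₀) * (1 + 8 * (131072 * (((4 : ℕ) : ℝ) + 1) ^ 2) * (B₁' * (α₀ + α₁))) ≤ 2 ∧
          2 * (B₁' * (α₀ + α₁)) ≤ c3 4 F.L ∧ ((4 : ℕ) : ℝ) * F.L * α₁ ≤ 1 / 8 ∧ α₀ ≤ cP ∧ α₁ ≤ cP ∧ B₁' * (α₀ + α₁) ≤ cP ∧
          2 * (B₁' * (α₀ + α₁)) ^ 2 + 20 * ((4 : ℕ) : ℝ) * α₀ * (B₁' * (α₀ + α₁)) + 2 * C₂ * (B₁' * (α₀ + α₁)) ^ 2 ≤ α₀ + α₁) ∧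
        B8.Thm4Body c₁ B₁' (fun i : {i : ZdIdx 4 F.L // (∀ j, i.Ω j = Set.univ) ∧ (∀ m j, i.Λs m j = {_y | j = m}) ∧ (∀ m j, i.Λb m j = {_c | j = m}) ∧ i.η = ((F.L : ℝ)⁻¹) ^ i.k} => (zdGF3 (Matrix (Fin N) (Fin N) ℂ) F.L 1 len i.1).toGFData) ∧
        B8.Prop3Body cP 4 (F.L : ℝ) C₂ inp B₀β (fun i : {i : ZdIdx 4 F.L // (∀ j, i.Ω j = Set.univ) ∧ (∀ m j, i.Λs m j = {_y | j = m}) ∧ (∀ m j, i.Λb m j = {_c | j = m}) ∧ i.η = ((F.L : ℝ)⁻¹) ^ i.k} => (zdGF3 (Matrix (Fin N) (Fin N) ℂ) F.L 1 len i.1).toGFData2))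
    (h7 : ∀ F : T4Family, ∃ C ε₀ : ℝ, 0 ≤ C ∧ 0 < ε₀ ∧ ∀ ε : ℝ, 0 < ε → ε ≤ ε₀ →
      LeafH3sup 4 F.L (ne3NperOfRecord₁₁ F 0 0) ε (C * ε) (C * ε) (ne3DomOfRecord₁₁ F N 0 0)) :
    ∃ ℓ₃ : T4Family → NE3Letters₁₁,
      S_N16 (RRec₁₃CoPROn (readingOfRecord₁₃CoPR w1 ℓ₃ ne2 ne1) Rg) ∧
      ∀ F : T4Family, (ℓ₃ F).g = g F ∧ (ℓ₃ F).Λ₁ = radiusOfRecord N F.L (ne3NperOfRecord₁₁ F 0 0) ∧ (ℓ₃ F).C = constOfRecord N F.L (ne3NperOfRecord₁₁ F 0 0) (g F) ∧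
        0 < (ℓ₃ F).b ∧ 512 * (4 + 1) * (4 + 4) * (F.L : ℝ) ^ 2 * (ℓ₃ F).b ≤ 1 ∧ 0 < (ℓ₃ F).Λ₂' ∧
        InEndRegime (ne3OfRecord₁₁ F (ne3ConstLayerOfRecord₁₁ F N (ℓ₃ F))) ∧ LeafSlotAT (ne3OfRecord₁₁ F (ne3ConstLayerOfRecord₁₁ F N (ℓ₃ F))) := by
  choose ℓ₃ hℓ₃ using fun F => exists_letters_inEndRegime_leafSlotAT_of_edges (N := N) F (hg F) (h5 F) (h7 F)
  exact ⟨ℓ₃, (s_N16_rRec₁₃CoPROn_iff_ofRecord (readingOfRecord₁₃CoPR w1 ℓ₃ ne2 ne1) Rg ℓ₃ (readingOfRecord₁₃CoPR_ne3 w1 ℓ₃ ne2 ne1)).2 fun F _ => n16At_of_inEndRegime_leafSlotAT (hℓ₃ F).2.2.2.2.2.2.1 (hℓ₃ F).2.2.2.2.2.2.2, hℓ₃⟩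

/-- **THE SAME AT THE CANONICAL READING OF RECORD** (`S_N16 (RRec₁₃CoPR (readingOfRecord₁₃CoPR w1 ℓ₃ ne2 ne1))`, module 23's `s_N16_readingOfRecord₁₃CoPR_of_leafSlot`). [folklore] -/
theorem exists_letters_s_N16_readingOfRecord₁₃CoPR_of_edges_allTorus {g : T4Family → ℝ} (hg : ∀ F, 0 < g F)
    (h5 : ∀ F : T4Family, letI : CStarAlgebra (Matrix (Fin N) (Fin N) ℂ) := {}
      ∃ (len : Site 4 → ℝ) (c₁ c₁' B₁' cP C₂ B₀β : ℝ) (inp : B8.B9Inputs),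
        (∀ v : Site 4, 0 < len v → 1 ≤ len v) ∧ (∀ μ : Fin 4, len (e μ) = 1) ∧ 0 < B₁' ∧ 5 * ((4 : ℕ) : ℝ) * F.L * inp.B₀ ≤ B₁' ∧ 0 < c₁' ∧
        (∀ α₀ α₁ : ℝ, 0 < α₀ → 0 < α₁ → α₀ + α₁ ≤ c₁' →
          α₀ + α₁ ≤ c₁ ∧ C0 4 * (2 * α₀) ≤ 1 / 3 ∧ 4 * α₀ ≤ c2' 4 F.L ∧ 16 * (B₁' * (α₀ + α₁)) ≤ 1 ∧
          Real.exp (4 * (800 * (((4 : ℕ) : ℝ) + 1) ^ 2 * (((4 : ℕ) : ℝ) + 4)) * α₀) * (1 + 8 * (131072 * (((4 : ℕ) : ℝ) + 1) ^ 2) * (B₁' * (α₀ + α₁))) ≤ 2 ∧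
          2 * (B₁' * (α₀ + α₁)) ≤ c3 4 F.L ∧ ((4 : ℕ) : ℝ) * F.L * α₁ ≤ 1 / 8 ∧ α₀ ≤ cP ∧ α₁ ≤ cP ∧ B₁' * (α₀ + α₁) ≤ cP ∧
          2 * (B₁' * (α₀ + α₁)) ^ 2 + 20 * ((4 : ℕ) : ℝ) * α₀ * (B₁' * (α₀ + α₁)) + 2 * C₂ * (B₁' * (α₀ + α₁)) ^ 2 ≤ α₀ + α₁) ∧
        B8.Thm4Body c₁ B₁' (fun i : {i : ZdIdx 4 F.L // (∀ j, i.Ω j = Set.univ) ∧ (∀ m j, i.Λs m j = {_y | j = m}) ∧ (∀ m j, i.Λb m j = {_c | j = m}) ∧ i.η = ((F.L : ℝ)⁻¹) ^ i.k} => (zdGF3 (Matrix (Fin N) (Fin N) ℂ) F.L 1 len i.1).toGFData) ∧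
        B8.Prop3Body cP 4 (F.L : ℝ) C₂ inp B₀β (fun i : {i : ZdIdx 4 F.L // (∀ j, i.Ω j = Set.univ) ∧ (∀ m j, i.Λs m j = {_y | j = m}) ∧ (∀ m j, i.Λb m j = {_c | j = m}) ∧ i.η = ((F.L : ℝ)⁻¹) ^ i.k} => (zdGF3 (Matrix (Fin N) (Fin N) ℂ) F.L 1 len i.1).toGFData2))
    (h7 : ∀ F : T4Family, ∃ C ε₀ : ℝ, 0 ≤ C ∧ 0 < ε₀ ∧ ∀ ε : ℝ, 0 < ε → ε ≤ ε₀ →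
      LeafH3sup 4 F.L (ne3NperOfRecord₁₁ F 0 0) ε (C * ε) (C * ε) (ne3DomOfRecord₁₁ F N 0 0)) :
    ∃ ℓ₃ : T4Family → NE3Letters₁₁,
      S_N16 (RRec₁₃CoPR (readingOfRecord₁₃CoPR w1 ℓ₃ ne2 ne1)) ∧
      ∀ F : T4Family, (ℓ₃ F).g = g F ∧ (ℓ₃ F).Λ₁ = radiusOfRecord N F.L (ne3NperOfRecord₁₁ F 0 0) ∧ (ℓ₃ F).C = constOfRecord N F.L (ne3NperOfRecord₁₁ F 0 0) (g F) ∧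
        0 < (ℓ₃ F).b ∧ 512 * (4 + 1) * (4 + 4) * (F.L : ℝ) ^ 2 * (ℓ₃ F).b ≤ 1 ∧ 0 < (ℓ₃ F).Λ₂' ∧
        InEndRegime (ne3OfRecord₁₁ F (ne3ConstLayerOfRecord₁₁ F N (ℓ₃ F))) ∧ LeafSlotAT (ne3OfRecord₁₁ F (ne3ConstLayerOfRecord₁₁ F N (ℓ₃ F))) := by
  choose ℓ₃ hℓ₃ using fun F => exists_letters_inEndRegime_leafSlotAT_of_edges (N := N) F (hg F) (h5 F) (h7 F)
  exact ⟨ℓ₃, (s_N16_rRec₁₃CoPR_iff_of_constLayer (readingOfRecord₁₃CoPR w1 ℓ₃ ne2 ne1) (fun F => ne3ConstLayerOfRecord₁₁ F N (ℓ₃ F)) (readingOfRecord₁₃CoPR_ne3 w1 ℓ₃ ne2 ne1)).2 fun F _ => n16At_of_inEndRegime_leafSlotAT (hℓ₃ F).2.2.2.2.2.2.1 (hℓ₃ F).2.2.2.2.2.2.2, hℓ₃⟩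

end One

/-! ## §2 R-β, `S_N16Holder β` (`0 ≤ β ≤ 1`) -/

section Holder

variable {β : ℝ} (hβ0 : 0 ≤ β) (hβ1 : β ≤ 1)
variable (Rg : (F : T4Family) → Stage13RParams F N → Prop)
  (w1 : (F : T4Family) → (θ : Stage13RParams F N) → ReadingData F (MatA N) θ.τ9.M)
  (ne2 : (F : T4Family) → Stage13RParams F N → (ℕ → ℝ) → List (ULoop F) → ℕ → NE2Objects₁₁)
  (ne1 : (F : T4Family) → Stage13RParams F N → (ℕ → ℝ) → List (ULoop F) → NE1pCarriers)
include hβ0 hβ1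

/-- ★ **N16 UNDER R-β AT THE REGIME-RESTRICTED READING OF RECORD FROM ITS TWO IN-EDGES, LETTERS CHOSEN** (`0 ≤ β ≤ 1`): N05's unpacked leaf (conjuncts at the PINNED all-torus proper sub-index) at exponent `β` and N07's linear leaf
at every family, `g F > 0`, give letters `ℓ₃` with `S_N16Holder β (RRec₁₃CoPROn (readingOfRecord₁₃CoPR w1 ℓ₃ ne2 ne1) Rg)` AND the per-family β-uniform proviso, leaf β-slot and N21's
numerals (module 35's per-family letters, the home's constant-layer iff, module 32's closer). [folklore] -/
theorem exists_letters_s_N16Holder_readingOfRecord₁₃CoPROn_of_edges_allTorus {g : T4Family → ℝ} (hg : ∀ F, 0 < g F)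
    (h5 : ∀ F : T4Family, letI : CStarAlgebra (Matrix (Fin N) (Fin N) ℂ) := {}
      ∃ (len : Site 4 → ℝ) (c₁ c₁' B₁' cP C₂ B₀β : ℝ) (inp : B8.B9Inputs),
        (∀ v : Site 4, 0 < len v → 1 ≤ len v) ∧ (∀ μ : Fin 4, len (e μ) = 1) ∧ 0 < B₁' ∧ 5 * ((4 : ℕ) : ℝ) * F.L * inp.B₀ ≤ B₁' ∧ 0 < c₁' ∧
        (∀ α₀ α₁ : ℝ, 0 < α₀ → 0 < α₁ → α₀ + α₁ ≤ c₁' →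
          α₀ + α₁ ≤ c₁ ∧ C0 4 * (2 * α₀) ≤ 1 / 3 ∧ 4 * α₀ ≤ c2' 4 F.L ∧ 16 * (B₁' * (α₀ + α₁)) ≤ 1 ∧
          Real.exp (4 * (800 * (((4 : ℕ) : ℝ) + 1) ^ 2 * (((4 : ℕ) : ℝ) + 4)) * α₀) * (1 + 8 * (131072 * (((4 : ℕ) : ℝ) + 1) ^ 2) * (B₁' * (α₀ + α₁))) ≤ 2 ∧
          2 * (B₁' * (α₀ + α₁)) ≤ c3 4 F.L ∧ ((4 : ℕ) : ℝ) * F.L * α₁ ≤ 1 / 8 ∧ α₀ ≤ cP ∧ α₁ ≤ cP ∧ B₁' * (α₀ + α₁) ≤ cP ∧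
          2 * (B₁' * (α₀ + α₁)) ^ 2 + 20 * ((4 : ℕ) : ℝ) * α₀ * (B₁' * (α₀ + α₁)) + 2 * C₂ * (B₁' * (α₀ + α₁)) ^ 2 ≤ α₀ + α₁) ∧
        B8.Thm4Body c₁ B₁' (fun i : {i : ZdIdx 4 F.L // (∀ j, i.Ω j = Set.univ) ∧ (∀ m j, i.Λs m j = {_y | j = m}) ∧ (∀ m j, i.Λb m j = {_c | j = m}) ∧ i.η = ((F.L : ℝ)⁻¹) ^ i.k} => (zdGF3 (Matrix (Fin N) (Fin N) ℂ) F.L β len i.1).toGFData) ∧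
        B8.Prop3Body cP 4 (F.L : ℝ) C₂ inp B₀β (fun i : {i : ZdIdx 4 F.L // (∀ j, i.Ω j = Set.univ) ∧ (∀ m j, i.Λs m j = {_y | j = m}) ∧ (∀ m j, i.Λb m j = {_c | j = m}) ∧ i.η = ((F.L : ℝ)⁻¹) ^ i.k} => (zdGF3 (Matrix (Fin N) (Fin N) ℂ) F.L β len i.1).toGFData2))
    (h7 : ∀ F : T4Family, ∃ C ε₀ : ℝ, 0 ≤ C ∧ 0 < ε₀ ∧ ∀ ε : ℝ, 0 < ε → ε ≤ ε₀ →
      LeafH3sup 4 F.L (ne3NperOfRecord₁₁ F 0 0) ε (C * ε) (C * ε) (ne3DomOfRecord₁₁ F N 0 0)) :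
    ∃ ℓ₃ : T4Family → NE3Letters₁₁,
      S_N16Holder β (RRec₁₃CoPROn (readingOfRecord₁₃CoPR w1 ℓ₃ ne2 ne1) Rg) ∧
      ∀ F : T4Family, (ℓ₃ F).g = g F ∧ (ℓ₃ F).Λ₁ = radiusOfRecordH N F.L (ne3NperOfRecord₁₁ F 0 0) ∧
        (ℓ₃ F).C = constOfRecordH N F.L (ne3NperOfRecord₁₁ F 0 0) (g F) ∧
        0 < (ℓ₃ F).b ∧ 512 * (4 + 1) * (4 + 4) * (F.L : ℝ) ^ 2 * (ℓ₃ F).b ≤ 1 ∧ 0 < (ℓ₃ F).Λ₂' ∧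
        InEndRegimeH (ne3OfRecord₁₁ F (ne3ConstLayerOfRecord₁₁ F N (ℓ₃ F))) ∧ LeafSlotHolderAT (ne3OfRecord₁₁ F (ne3ConstLayerOfRecord₁₁ F N (ℓ₃ F))) β := by
  choose ℓ₃ hℓ₃ using fun F => exists_letters_inEndRegimeH_leafSlotHolderAT_of_edges (N := N) F (hg F) (h5 F) (h7 F)
  exact ⟨ℓ₃, (s_N16Holder_rRec₁₃CoPROn_iff_ofRecord β (readingOfRecord₁₃CoPR w1 ℓ₃ ne2 ne1) Rg ℓ₃ (readingOfRecord₁₃CoPR_ne3 w1 ℓ₃ ne2 ne1)).2 fun F _ => n16HolderAt_of_inEndRegimeH_leafSlotHolderAT (hℓ₃ F).2.2.2.2.2.2.1 hβ0 hβ1 (hℓ₃ F).2.2.2.2.2.2.2, hℓ₃⟩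

/-- **THE SAME AT THE CANONICAL READING OF RECORD** (`S_N16Holder β (RRec₁₃CoPR (readingOfRecord₁₃CoPR w1 ℓ₃ ne2 ne1))`). [folklore] -/
theorem exists_letters_s_N16Holder_readingOfRecord₁₃CoPR_of_edges_allTorus {g : T4Family → ℝ} (hg : ∀ F, 0 < g F)
    (h5 : ∀ F : T4Family, letI : CStarAlgebra (Matrix (Fin N) (Fin N) ℂ) := {}
      ∃ (len : Site 4 → ℝ) (c₁ c₁' B₁' cP C₂ B₀β : ℝ) (inp : B8.B9Inputs),
        (∀ v : Site 4, 0 < len v → 1 ≤ len v) ∧ (∀ μ : Fin 4, len (e μ) = 1) ∧ 0 < B₁' ∧ 5 * ((4 : ℕ) : ℝ) * F.L * inp.B₀ ≤ B₁' ∧ 0 < c₁' ∧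
        (∀ α₀ α₁ : ℝ, 0 < α₀ → 0 < α₁ → α₀ + α₁ ≤ c₁' →
          α₀ + α₁ ≤ c₁ ∧ C0 4 * (2 * α₀) ≤ 1 / 3 ∧ 4 * α₀ ≤ c2' 4 F.L ∧ 16 * (B₁' * (α₀ + α₁)) ≤ 1 ∧
          Real.exp (4 * (800 * (((4 : ℕ) : ℝ) + 1) ^ 2 * (((4 : ℕ) : ℝ) + 4)) * α₀) * (1 + 8 * (131072 * (((4 : ℕ) : ℝ) + 1) ^ 2) * (B₁' * (α₀ + α₁))) ≤ 2 ∧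
          2 * (B₁' * (α₀ + α₁)) ≤ c3 4 F.L ∧ ((4 : ℕ) : ℝ) * F.L * α₁ ≤ 1 / 8 ∧ α₀ ≤ cP ∧ α₁ ≤ cP ∧ B₁' * (α₀ + α₁) ≤ cP ∧
          2 * (B₁' * (α₀ + α₁)) ^ 2 + 20 * ((4 : ℕ) : ℝ) * α₀ * (B₁' * (α₀ + α₁)) + 2 * C₂ * (B₁' * (α₀ + α₁)) ^ 2 ≤ α₀ + α₁) ∧
        B8.Thm4Body c₁ B₁' (fun i : {i : ZdIdx 4 F.L // (∀ j, i.Ω j = Set.univ) ∧ (∀ m j, i.Λs m j = {_y | j = m}) ∧ (∀ m j, i.Λb m j = {_c | j = m}) ∧ i.η = ((F.L : ℝ)⁻¹) ^ i.k} => (zdGF3 (Matrix (Fin N) (Fin N) ℂ) F.L β len i.1).toGFData) ∧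
        B8.Prop3Body cP 4 (F.L : ℝ) C₂ inp B₀β (fun i : {i : ZdIdx 4 F.L // (∀ j, i.Ω j = Set.univ) ∧ (∀ m j, i.Λs m j = {_y | j = m}) ∧ (∀ m j, i.Λb m j = {_c | j = m}) ∧ i.η = ((F.L : ℝ)⁻¹) ^ i.k} => (zdGF3 (Matrix (Fin N) (Fin N) ℂ) F.L β len i.1).toGFData2))
    (h7 : ∀ F : T4Family, ∃ C ε₀ : ℝ, 0 ≤ C ∧ 0 < ε₀ ∧ ∀ ε : ℝ, 0 < ε → ε ≤ ε₀ →
      LeafH3sup 4 F.L (ne3NperOfRecord₁₁ F 0 0) ε (C * ε) (C * ε) (ne3DomOfRecord₁₁ F N 0 0)) :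
    ∃ ℓ₃ : T4Family → NE3Letters₁₁,
      S_N16Holder β (RRec₁₃CoPR (readingOfRecord₁₃CoPR w1 ℓ₃ ne2 ne1)) ∧
      ∀ F : T4Family, (ℓ₃ F).g = g F ∧ (ℓ₃ F).Λ₁ = radiusOfRecordH N F.L (ne3NperOfRecord₁₁ F 0 0) ∧
        (ℓ₃ F).C = constOfRecordH N F.L (ne3NperOfRecord₁₁ F 0 0) (g F) ∧
        0 < (ℓ₃ F).b ∧ 512 * (4 + 1) * (4 + 4) * (F.L : ℝ) ^ 2 * (ℓ₃ F).b ≤ 1 ∧ 0 < (ℓ₃ F).Λ₂' ∧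
        InEndRegimeH (ne3OfRecord₁₁ F (ne3ConstLayerOfRecord₁₁ F N (ℓ₃ F))) ∧ LeafSlotHolderAT (ne3OfRecord₁₁ F (ne3ConstLayerOfRecord₁₁ F N (ℓ₃ F))) β := by
  choose ℓ₃ hℓ₃ using fun F => exists_letters_inEndRegimeH_leafSlotHolderAT_of_edges (N := N) F (hg F) (h5 F) (h7 F)
  exact ⟨ℓ₃, (s_N16Holder_rRec₁₃CoPR_iff_of_constLayer β (readingOfRecord₁₃CoPR w1 ℓ₃ ne2 ne1) (fun F => ne3ConstLayerOfRecord₁₁ F N (ℓ₃ F)) (readingOfRecord₁₃CoPR_ne3 w1 ℓ₃ ne2 ne1)).2 fun F _ => n16HolderAt_of_inEndRegimeH_leafSlotHolderAT (hℓ₃ F).2.2.2.2.2.2.1 hβ0 hβ1 (hℓ₃ F).2.2.2.2.2.2.2, hℓ₃⟩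

end Holder

/-! ## §3 R-β″, `S_N16HolderMS β` (`0 ≤ β ≤ 1`, MS length letter) -/

section MS

variable {β : ℝ} (hβ0 : 0 ≤ β) (hβ1 : β ≤ 1)
variable (Rg : (F : T4Family) → Stage13RParams F N → Prop)
  (w1 : (F : T4Family) → (θ : Stage13RParams F N) → ReadingData F (MatA N) θ.τ9.M)
  (ne2 : (F : T4Family) → Stage13RParams F N → (ℕ → ℝ) → List (ULoop F) → ℕ → NE2Objects₁₁)
  (ne1 : (F : T4Family) → Stage13RParams F N → (ℕ → ℝ) → List (ULoop F) → NE1pCarriers)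
include hβ0 hβ1

/-- ★ **N16 UNDER R-β″ AT THE REGIME-RESTRICTED READING OF RECORD FROM ITS TWO IN-EDGES, LETTERS CHOSEN** (`0 ≤ β ≤ 1`): N05's unpacked leaf (conjuncts at the PINNED all-torus proper sub-index) at exponent `β` (MS length letter) and
N07's linear leaf at every family, `g F > 0`, give letters `ℓ₃` with `S_N16HolderMS β (RRec₁₃CoPROn (readingOfRecord₁₃CoPR w1 ℓ₃ ne2 ne1) Rg)` AND the per-family MS proviso, MS slot and N21's
numerals (module 35's per-family letters, the home's constant-layer iff, module 32's closer). [folklore] -/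
theorem exists_letters_s_N16HolderMS_readingOfRecord₁₃CoPROn_of_edges_allTorus {g : T4Family → ℝ} (hg : ∀ F, 0 < g F)
    (h5 : ∀ F : T4Family, letI : CStarAlgebra (Matrix (Fin N) (Fin N) ℂ) := {}
      ∃ (len : Site 4 → ℝ) (c₁ c₁' B₁' cP C₂ B₀β : ℝ) (inp : B8.B9Inputs),
        (∀ v : Site 4, 0 < len v → 1 ≤ len v) ∧ (∀ (μ : Fin 4) (j : ℕ), len (j • e μ) = j) ∧ 0 < B₁' ∧ 5 * ((4 : ℕ) : ℝ) * F.L * inp.B₀ ≤ B₁' ∧ 0 < c₁' ∧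
        (∀ α₀ α₁ : ℝ, 0 < α₀ → 0 < α₁ → α₀ + α₁ ≤ c₁' →
          α₀ + α₁ ≤ c₁ ∧ C0 4 * (2 * α₀) ≤ 1 / 3 ∧ 4 * α₀ ≤ c2' 4 F.L ∧ 16 * (B₁' * (α₀ + α₁)) ≤ 1 ∧
          Real.exp (4 * (800 * (((4 : ℕ) : ℝ) + 1) ^ 2 * (((4 : ℕ) : ℝ) + 4)) * α₀) * (1 + 8 * (131072 * (((4 : ℕ) : ℝ) + 1) ^ 2) * (B₁' * (α₀ + α₁))) ≤ 2 ∧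
          2 * (B₁' * (α₀ + α₁)) ≤ c3 4 F.L ∧ ((4 : ℕ) : ℝ) * F.L * α₁ ≤ 1 / 8 ∧ α₀ ≤ cP ∧ α₁ ≤ cP ∧ B₁' * (α₀ + α₁) ≤ cP ∧
          2 * (B₁' * (α₀ + α₁)) ^ 2 + 20 * ((4 : ℕ) : ℝ) * α₀ * (B₁' * (α₀ + α₁)) + 2 * C₂ * (B₁' * (α₀ + α₁)) ^ 2 ≤ α₀ + α₁) ∧
        B8.Thm4Body c₁ B₁' (fun i : {i : ZdIdx 4 F.L // (∀ j, i.Ω j = Set.univ) ∧ (∀ m j, i.Λs m j = {_y | j = m}) ∧ (∀ m j, i.Λb m j = {_c | j = m}) ∧ i.η = ((F.L : ℝ)⁻¹) ^ i.k} => (zdGF3 (Matrix (Fin N) (Fin N) ℂ) F.L β len i.1).toGFData) ∧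
        B8.Prop3Body cP 4 (F.L : ℝ) C₂ inp B₀β (fun i : {i : ZdIdx 4 F.L // (∀ j, i.Ω j = Set.univ) ∧ (∀ m j, i.Λs m j = {_y | j = m}) ∧ (∀ m j, i.Λb m j = {_c | j = m}) ∧ i.η = ((F.L : ℝ)⁻¹) ^ i.k} => (zdGF3 (Matrix (Fin N) (Fin N) ℂ) F.L β len i.1).toGFData2))
    (h7 : ∀ F : T4Family, ∃ C ε₀ : ℝ, 0 ≤ C ∧ 0 < ε₀ ∧ ∀ ε : ℝ, 0 < ε → ε ≤ ε₀ →
      LeafH3sup 4 F.L (ne3NperOfRecord₁₁ F 0 0) ε (C * ε) (C * ε) (ne3DomOfRecord₁₁ F N 0 0)) :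
    ∃ ℓ₃ : T4Family → NE3Letters₁₁,
      S_N16HolderMS β (RRec₁₃CoPROn (readingOfRecord₁₃CoPR w1 ℓ₃ ne2 ne1) Rg) ∧
      ∀ F : T4Family, (ℓ₃ F).g = g F ∧ (ℓ₃ F).Λ₁ = radiusOfRecordHMS N F.L (ne3NperOfRecord₁₁ F 0 0) ∧
        (ℓ₃ F).C = constOfRecordHMS N F.L (ne3NperOfRecord₁₁ F 0 0) (g F) ∧
        0 < (ℓ₃ F).b ∧ 512 * (4 + 1) * (4 + 4) * (F.L : ℝ) ^ 2 * (ℓ₃ F).b ≤ 1 ∧ 0 < (ℓ₃ F).Λ₂' ∧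
        InEndRegimeHMS (ne3OfRecord₁₁ F (ne3ConstLayerOfRecord₁₁ F N (ℓ₃ F))) ∧ LeafSlotHolderMSAT (ne3OfRecord₁₁ F (ne3ConstLayerOfRecord₁₁ F N (ℓ₃ F))) β := by
  choose ℓ₃ hℓ₃ using fun F => exists_letters_inEndRegimeHMS_leafSlotHolderMSAT_of_edges (N := N) F (hg F) (h5 F) (h7 F)
  exact ⟨ℓ₃, (s_N16HolderMS_rRec₁₃CoPROn_iff_ofRecord β (readingOfRecord₁₃CoPR w1 ℓ₃ ne2 ne1) Rg ℓ₃ (readingOfRecord₁₃CoPR_ne3 w1 ℓ₃ ne2 ne1)).2 fun F _ => n16HolderMSAt_of_inEndRegimeHMS_leafSlotHolderMSAT (hℓ₃ F).2.2.2.2.2.2.1 hβ0 hβ1 (hℓ₃ F).2.2.2.2.2.2.2, hℓ₃⟩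

/-- **THE SAME AT THE CANONICAL READING OF RECORD** (`S_N16HolderMS β (RRec₁₃CoPR (readingOfRecord₁₃CoPR w1 ℓ₃ ne2 ne1))`). [folklore] -/
theorem exists_letters_s_N16HolderMS_readingOfRecord₁₃CoPR_of_edges_allTorus {g : T4Family → ℝ} (hg : ∀ F, 0 < g F)
    (h5 : ∀ F : T4Family, letI : CStarAlgebra (Matrix (Fin N) (Fin N) ℂ) := {}
      ∃ (len : Site 4 → ℝ) (c₁ c₁' B₁' cP C₂ B₀β : ℝ) (inp : B8.B9Inputs),
        (∀ v : Site 4, 0 < len v → 1 ≤ len v) ∧ (∀ (μ : Fin 4) (j : ℕ), len (j • e μ) = j) ∧ 0 < B₁' ∧ 5 * ((4 : ℕ) : ℝ) * F.L * inp.B₀ ≤ B₁' ∧ 0 < c₁' ∧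
        (∀ α₀ α₁ : ℝ, 0 < α₀ → 0 < α₁ → α₀ + α₁ ≤ c₁' →
          α₀ + α₁ ≤ c₁ ∧ C0 4 * (2 * α₀) ≤ 1 / 3 ∧ 4 * α₀ ≤ c2' 4 F.L ∧ 16 * (B₁' * (α₀ + α₁)) ≤ 1 ∧
          Real.exp (4 * (800 * (((4 : ℕ) : ℝ) + 1) ^ 2 * (((4 : ℕ) : ℝ) + 4)) * α₀) * (1 + 8 * (131072 * (((4 : ℕ) : ℝ) + 1) ^ 2) * (B₁' * (α₀ + α₁))) ≤ 2 ∧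
          2 * (B₁' * (α₀ + α₁)) ≤ c3 4 F.L ∧ ((4 : ℕ) : ℝ) * F.L * α₁ ≤ 1 / 8 ∧ α₀ ≤ cP ∧ α₁ ≤ cP ∧ B₁' * (α₀ + α₁) ≤ cP ∧
          2 * (B₁' * (α₀ + α₁)) ^ 2 + 20 * ((4 : ℕ) : ℝ) * α₀ * (B₁' * (α₀ + α₁)) + 2 * C₂ * (B₁' * (α₀ + α₁)) ^ 2 ≤ α₀ + α₁) ∧
        B8.Thm4Body c₁ B₁' (fun i : {i : ZdIdx 4 F.L // (∀ j, i.Ω j = Set.univ) ∧ (∀ m j, i.Λs m j = {_y | j = m}) ∧ (∀ m j, i.Λb m j = {_c | j = m}) ∧ i.η = ((F.L : ℝ)⁻¹) ^ i.k} => (zdGF3 (Matrix (Fin N) (Fin N) ℂ) F.L β len i.1).toGFData) ∧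
        B8.Prop3Body cP 4 (F.L : ℝ) C₂ inp B₀β (fun i : {i : ZdIdx 4 F.L // (∀ j, i.Ω j = Set.univ) ∧ (∀ m j, i.Λs m j = {_y | j = m}) ∧ (∀ m j, i.Λb m j = {_c | j = m}) ∧ i.η = ((F.L : ℝ)⁻¹) ^ i.k} => (zdGF3 (Matrix (Fin N) (Fin N) ℂ) F.L β len i.1).toGFData2))
    (h7 : ∀ F : T4Family, ∃ C ε₀ : ℝ, 0 ≤ C ∧ 0 < ε₀ ∧ ∀ ε : ℝ, 0 < ε → ε ≤ ε₀ →
      LeafH3sup 4 F.L (ne3NperOfRecord₁₁ F 0 0) ε (C * ε) (C * ε) (ne3DomOfRecord₁₁ F N 0 0)) :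
    ∃ ℓ₃ : T4Family → NE3Letters₁₁,
      S_N16HolderMS β (RRec₁₃CoPR (readingOfRecord₁₃CoPR w1 ℓ₃ ne2 ne1)) ∧
      ∀ F : T4Family, (ℓ₃ F).g = g F ∧ (ℓ₃ F).Λ₁ = radiusOfRecordHMS N F.L (ne3NperOfRecord₁₁ F 0 0) ∧
        (ℓ₃ F).C = constOfRecordHMS N F.L (ne3NperOfRecord₁₁ F 0 0) (g F) ∧
        0 < (ℓ₃ F).b ∧ 512 * (4 + 1) * (4 + 4) * (F.L : ℝ) ^ 2 * (ℓ₃ F).b ≤ 1 ∧ 0 < (ℓ₃ F).Λ₂' ∧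
        InEndRegimeHMS (ne3OfRecord₁₁ F (ne3ConstLayerOfRecord₁₁ F N (ℓ₃ F))) ∧ LeafSlotHolderMSAT (ne3OfRecord₁₁ F (ne3ConstLayerOfRecord₁₁ F N (ℓ₃ F))) β := by
  choose ℓ₃ hℓ₃ using fun F => exists_letters_inEndRegimeHMS_leafSlotHolderMSAT_of_edges (N := N) F (hg F) (h5 F) (h7 F)
  exact ⟨ℓ₃, (s_N16HolderMS_rRec₁₃CoPR_iff_ofRecord β (readingOfRecord₁₃CoPR w1 ℓ₃ ne2 ne1) ℓ₃ (readingOfRecord₁₃CoPR_ne3 w1 ℓ₃ ne2 ne1)).2 fun F _ => n16HolderMSAt_of_inEndRegimeHMS_leafSlotHolderMSAT (hℓ₃ F).2.2.2.2.2.2.1 hβ0 hβ1 (hℓ₃ F).2.2.2.2.2.2.2, hℓ₃⟩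

end MS

end

end Summit.QuantumFields.YangMills.BalabanUVNodes.N16OfEdgesAllTorusAtRecord13CoPR
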